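import Literature.Probability.RandomPlanarGeometry.HexSAWRotStripClasses
import Literature.Probability.RandomPlanarGeometry.HexSAWRotStripMonotone
import HarnessLib

/-!
# Beaton's triangle `T_M` in the rotated honeycomb frame: exit classes, side windings, and the triangle identity

Topic `Literature/Probability/RandomPlanarGeometry` (continues `HexSAWRotStripClasses.lean`: the exit classes of Beaton's
rotated strip `D(H, W)`, their windings and boundary terms, `HV.rotGF`, and Beaton 2014 Prop. 4 = `HV.rotStrip_identity`;
lane «pcv-sawmu», door R95 «HEX-BW-GM-ROT» of planner a-idea-1, face **K95.2 «ROT-TRI-IDENTITY»**).  Sources: N. R. Beaton,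
*The critical surface fugacity of self-avoiding walks on a rotated honeycomb lattice*, J. Phys. A 47 (2014) 075003
(arXiv:1210.0274v3), §2.2 and Proposition 4 with its proof (the local identity summed over a domain on one side of the start
edge, the exits sorted by boundary part, the adjusted winding `W* = W ± π/2`); A. Glazman, I. Manolescu, *Self-avoiding walk
on `ℤ²` with Yang–Baxter weights: universality of critical fugacity and 2-point function*, Ann. Inst. Henri Poincaré Probab.
Stat. (2019/2020) (arXiv:1708.00395), §4.1 (the triangles `T_L ⊆ S_T` and the comparison of the strip partition function
with a triangle functional, Lemma 4.1); H. Duminil-Copin, S. Smirnov, Ann. of Math. 175 (2012), Lemma 1 and the proof of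
Lemma 2 (Hopf).

Status in print: Beaton proves the identity of Proposition 4 for the rotated STRIP `D_{T,L}`; the same summation over the
rotated equilateral TRIANGLE `T_M` (apex above the start edge, sides at `±60°`, the exits through the two sides sorted by edge
type: `ε`-type = `Δξ = 0` edges with Beaton's coefficient `c_E = 2cos(3π/16)`, `β`-type = upward slanted edges with
`c_B = 2cos(π/16)`) is the device of Glazman–Manolescu §4.1 transported to Beaton's frame by the lane's planner (a-idea-1,
ROUTES-G15 §2.3 S2, face K95.2); it is not printed as such.  The content of this file is therefore a VARIANT of a printed
identity (same proof: DCS Lemma 1 summed, Hopf per exit class), machine-checked.  Label of record (lane lit-1, 2026-08-23):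
«CONSOLIDATION-grade new text: rotated-frame triangle identity = GM20 §4.1 mechanism × Beaton14 Prop 4 coefficients; first
written statement + first kernel text; the R95 door's novelty is downstream (K95.4a `RotTourKeyIneq` / block decay), not here»
— nearest print: Glazman–Manolescu §4.1, proof of Lemma 4.1 (arXiv p. 12), the triangle identity
`cos(3π/8)·A^Δ_{2L+1} + cos(π/8)·D^Δ_{2L+1} = 1` in the Duminil-Copin–Smirnov strip frame; Beaton 2014 has no triangle
domain.  Its first
use is included (K95.3: `c_B · B_{D(H,W)} ≤ W_M` for `T_M ⊆ D(H, W)` and `W_M` antitone in `M` — Glazman–Manolescu's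
comparison (4.1), whose printed setting is the unrotated strip with Yang–Baxter weights); the decay of `W_M` (the rotated
GM tour, face K95.4a) is NOT here.

## Contents (namespace `Literature.Probability.RandomPlanarGeometry.SAW.HV`)

* `rotTriV M` = `T_M` (`1 ≤ -ξ`, `-6M - ξ < X < 6M + 6 + ξ`, plus `a∓`), `mem_rotTriV_iff`, `rotTriV_mono` (nesting),
  `rotTriV_subset_rotStripV` (`T_M ⊆ D(6M+2, 2M+1)`), the side classes `IsRotSideDart`, `IsRotSideEps`, `IsRotSideBeta`,
  the functional `rotTriW M = 2cos(3π/16)·E_M + 2cos(π/16)·B_M` — texts of the planner's sketch (`Sketch_G17b_K954.lean`), verbatim;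
* `xX_add_xi_even` (the parity `X ≡ ξ (mod 2)`), **`rotTri_exit_classes`** (every half-edge out of `T_M ∖ {a⁻}` is bottom-in,
  bottom-out, side-`ε`, side-`β`, closing, or the stub — all `M`, including `M = 0`), `rotTri_classes_disjoint`,
  `not_mem_rotTriV_of_class`, **`rotTri_exit_iff`**;
* the TILTED Hopf evaluation for the two sides (`c₂ = -I·ω` behind the right side `X - ξ = 6M + 6`, `c₂ = I·ω²` behind the
  left side `X + ξ = -6M`; `arg_omg_mul_of_im_nonneg`): **`pturn_of_isRotSideEps`** (`0 / 3`, right / left) and **`pturn_of_isRotSideBeta`**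
  (`1 / 2`) — the same windings as the strip's lateral and top exits — and the boundary terms `Re T = cos(3π/16)`, `cos(π/16)`;
* the bottom, closing and stub classes are read through `T_M ⊆ D(6M+2, 2M+1)` from `HexSAWRotStripClasses`;
* **`rotTri_identity` / `rotTri_identity_all`** (face K95.2, token for token):
  `2 sin(3π/16) A^O_M + 2 sin(π/16) A^I_M + W_M + 2cos(7π/16) P_M = 2 x_c cos(π/16)` for every `M`; `rotTriW_le`;
* the COMPARISON (face K95.3, Glazman–Manolescu (4.1) in Beaton's frame, now unconditional): `rotGF_nonneg`, `rotGF_mono`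
  (planner's texts), `rot_coeff_pos`, **`rotTriW_antitone`**, **`rotStripBR_le_rotTriW`** (`2cos(π/16) · B^{⊥,→}_{D(H,W)} ≤ W_M`
  for `6M+2 ≤ H`, `2M+1 ≤ W`), `rotStripBR_le_rotTriW_all` (every width, with `HexSAWRotStripMonotone`).
-/

noncomputable section

namespace Literature.Probability.RandomPlanarGeometry.SAW

namespace HV

open Finset Real Complex

/-! ### The rotated triangle `T_M`, its side classes and the functional `W_M` (planner's texts, verbatim) -/

/-- **The rotated triangle `T_M`** (ROUTES-G15 §2.3 S2; `c_tri.py tri M`): corners `c₀ = (-3M, 0)`,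
`c₁ = (3M+3, 0)` on `ℓ` (hexagon centres, in edge units from the start hexagon row), apex above `a`;
vertices strictly above `ℓ` and strictly inside the two 60° side lines, plus `a∓`; in the integer model
`Y ≥ 1 ∧ -6M + Y < X < 6M + 6 - Y`. Same `a` for every `M` (NESTED: `T_M ⊆ T_{M+1}`), whence the
antitonicity of `W_M`. Kernel sanity: `|T_1| = 20`, `|T_2| = 62` (= `c_tri.py`). [cite: GlazmanManolescu2019, §4.1 (T_L); Beaton2014RotatedHoneycomb, §3.1] -/
def rotTriV (M : ℕ) : Finset HV :=
  insert wOut (insert hvOrigin (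
    ((Icc (-(5 : ℤ) * M - 4) (M + 3)) ×ˢ (Icc (-(2 : ℤ) * M - 4) (2 * M + 2)) ×ˢ (univ : Finset Bool)).filter
      (fun v => 1 ≤ -xi v ∧ -(6 : ℤ) * M - xi v < xX v ∧ xX v < 6 * M + 6 + xi v)))

/-- The box in `rotTriV` is large enough: membership is the three inequalities (for `v ∉ {a∓}`).
[cite: GlazmanManolescu2019, §4.1 (T_L)] -/
theorem mem_rotTriV_of {M : ℕ} {v : HV} (h1 : 1 ≤ -xi v) (h2 : -(6 : ℤ) * M - xi v < xX v)
    (h3 : xX v < 6 * M + 6 + xi v) : v ∈ rotTriV M := by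
  obtain ⟨a, b, c⟩ := v
  simp only [rotTriV, mem_insert, mem_filter, mem_product, mem_Icc, mem_univ, and_true]
  refine Or.inr (Or.inr ⟨⟨⟨?_, ?_⟩, ?_, ?_⟩, h1, h2, h3⟩) <;>
    cases c <;> simp [xi, xX, bit] at h1 h2 h3 ⊢ <;> omega

/-- Membership in `T_M` = the three inequalities (box-free form). [cite: GlazmanManolescu2019, §4.1 (T_L)] -/
theorem mem_rotTriV_iff {M : ℕ} {v : HV} : v ∈ rotTriV M ↔
    v = wOut ∨ v = hvOrigin ∨ (1 ≤ -xi v ∧ -(6 : ℤ) * M - xi v < xX v ∧ xX v < 6 * M + 6 + xi v) := by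
  constructor
  · intro hv
    simp only [rotTriV, mem_insert, mem_filter, mem_product, mem_Icc, mem_univ, and_true] at hv
    rcases hv with rfl | rfl | ⟨-, h⟩
    · exact Or.inl rfl
    · exact Or.inr (Or.inl rfl)
    · exact Or.inr (Or.inr h)
  · rintro (rfl | rfl | ⟨h1, h2, h3⟩)
    · exact mem_insert_self _ _
    · exact mem_insert_of_mem (mem_insert_self _ _)
    · exact mem_rotTriV_of h1 h2 h3

/-- NESTING `T_M ⊆ T_{M+1}` (same `a`). [cite: GlazmanManolescu2019, §4.1] -/
theorem rotTriV_mono {M M' : ℕ} (h : M ≤ M') : rotTriV M ⊆ rotTriV M' := by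
  intro v hv
  simp only [rotTriV, mem_insert, mem_filter, mem_product, mem_Icc, mem_univ, and_true] at hv
  rcases hv with rfl | rfl | ⟨-, h1, h2, h3⟩
  · exact mem_insert_self _ _
  · exact mem_insert_of_mem (mem_insert_self _ _)
  · have hM : (M : ℤ) ≤ M' := by exact_mod_cast h
    exact mem_rotTriV_of h1 (by linarith) (by linarith)

/-- `T_M ⊆ D(H, W)` once `6M + 2 ≤ H` and `2M + 1 ≤ W` (half-widths `6M+3 ≤ 3W` in `X`-units; the
comparison step S2/K95.3 uses this and the width-monotonicity of `rotStripBR`).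
[cite: GlazmanManolescu2019, Lemma 4.1] -/
theorem rotTriV_subset_rotStripV {M H Wd : ℕ} (hH : 6 * M + 2 ≤ H) (hW : 2 * M + 1 ≤ Wd) :
    rotTriV M ⊆ rotStripV H Wd := by
  intro v hv
  simp only [rotTriV, mem_insert, mem_filter, mem_product, mem_Icc, mem_univ, and_true] at hv
  rcases hv with rfl | rfl | ⟨-, h1, h2, h3⟩
  · exact mem_insert_self _ _
  · exact mem_insert_of_mem (mem_insert_self _ _)
  · obtain ⟨a, b, c⟩ := v
    have hH' : (6 : ℤ) * M + 2 ≤ H := by exact_mod_cast hH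
    have hW' : 2 * (M : ℤ) + 1 ≤ Wd := by exact_mod_cast hW
    simp only [rotStripV, mem_insert, mem_filter, mem_product, mem_Icc, mem_univ, and_true]
    refine Or.inr (Or.inr ⟨⟨⟨?_, ?_⟩, ?_, ?_⟩, h1, ?_, ?_⟩) <;>
      cases c <;> simp [xi, xX, bit, abs_lt] at h1 h2 h3 ⊢ <;> omega

/-- side exits of `T_M` onto the LEFT line `xX = -6M - ξ` / RIGHT line `xX = 6M + 6 + ξ`, split by
edge type: `ε`-type (`Δξ = 0`, Beaton heading 0°/180°) and `β`-type (`Δ(-ξ) = +1`, heading 60°/120°).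
[cite: GlazmanManolescu2019, §4.1; Beaton2014RotatedHoneycomb, §3.1] -/
def IsRotSideDart (M : ℕ) (d : HV × HV) : Prop :=
  xX d.2 = -(6 : ℤ) * M - xi d.2 ∨ xX d.2 = 6 * M + 6 + xi d.2
/-- `ε`-type side exit (`Δξ = 0`). [cite: Beaton2014RotatedHoneycomb, §2.2 (ε)] -/
def IsRotSideEps (M : ℕ) (d : HV × HV) : Prop := IsRotSideDart M d ∧ xi d.2 = xi d.1
/-- `β`-type side exit (`Δ(-ξ) = +1`). [cite: Beaton2014RotatedHoneycomb, §2.2 (β)] -/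
def IsRotSideBeta (M : ℕ) (d : HV × HV) : Prop := IsRotSideDart M d ∧ xi d.2 = xi d.1 - 1

/-- Decidability of the side class predicate (the generating functions are `Finset.filter` sums). [cite: Beaton2014RotatedHoneycomb, §2.2] -/
instance (M : ℕ) : DecidablePred (IsRotSideDart M) := fun d => by unfold IsRotSideDart; infer_instance
/-- Decidability of the side class predicate (the generating functions are `Finset.filter` sums). [cite: Beaton2014RotatedHoneycomb, §2.2] -/
instance (M : ℕ) : DecidablePred (IsRotSideEps M) := fun d => by unfold IsRotSideEps; infer_instance
/-- Decidability of the side class predicate (the generating functions are `Finset.filter` sums). [cite: Beaton2014RotatedHoneycomb, §2.2] -/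
instance (M : ℕ) : DecidablePred (IsRotSideBeta M) := fun d => by unfold IsRotSideBeta; infer_instance

/-- **`W_M`** (ROUTES-G15 §2.3 S2), right-started normalisation: `W_M := c_E D^ε_M + c_B D^β_M` with
Beaton's printed `c_E = √(2+√(2-√2)) = 2cos(3π/16)`, `c_B = √(2+√(2+√2)) = 2cos(π/16)` [p.6 L17–L18].
(`W_0 = c_B x_c = K/2 = 1.0616`; `c_tri.py` prints the both-starts values `2 W_M`: `W_1 = 1.5975/2`,
`W_2 = 1.4019/2`.) [cite: Beaton2014RotatedHoneycomb, Prop. 4; GlazmanManolescu2019, §4.1] -/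
def rotTriW (M : ℕ) : ℝ :=
  2 * Real.cos (3 * Real.pi / 16) * rotGF ((rotTriV M).erase wOut) (IsRotSideEps M) +
    2 * Real.cos (Real.pi / 16) * rotGF ((rotTriV M).erase wOut) (IsRotSideBeta M)

/-- Kernel sanity (planner's checks): `|T_1| = 20`, `|T_2| = 62`. [cite: GlazmanManolescu2019, §4.1 (T_L)] -/
example : (rotTriV 1).card = 20 ∧ (rotTriV 2).card = 62 := by constructor <;> decide

/-! ### The classification of the exits of `T_M` -/

/-- **Parity of the rotated frame**: `X + ξ = 2x₀ + 4x₁ + 2b + 4` is even, so `X ≡ -ξ (mod 2)`; in particular the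
side lines `X = -6M + (-ξ)` and `X = 6M + 6 - (-ξ)` have the parity of the row and are hit exactly.
[cite: Beaton2014RotatedHoneycomb, §2.2 (Fig. 3)] -/
theorem xX_add_xi_even (v : HV) : (xX v + xi v) % 2 = 0 := by
  obtain ⟨a, b, c⟩ := v
  cases c <;> simp [xX, xi] <;> omega

/-- `ξ ≤ 0` on `T_M` (`a∓` have `ξ = 0`, the others `ξ ≤ -1`). [cite: GlazmanManolescu2019, §4.1 (T_L)] -/
theorem xi_le_zero_of_mem_rotTriV {M : ℕ} {v : HV} (hv : v ∈ rotTriV M) : xi v ≤ 0 := by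
  rcases mem_rotTriV_iff.1 hv with rfl | rfl | ⟨h, -, -⟩
  · rw [xi_wOut]
  · rw [xi_hvOrigin]
  · omega

/-- The two tilted constraints hold on all of `T_M` (for `a∓`: `X ∓ ξ ∈ {2, 4}`), non-strictly:
`-6M ≤ X + ξ` … in fact `-6M < X + ξ` and `X - ξ < 6M + 6`. [cite: GlazmanManolescu2019, §4.1 (T_L)] -/
theorem tilt_bounds_of_mem_rotTriV {M : ℕ} {v : HV} (hv : v ∈ rotTriV M) :
    -(6 : ℤ) * M < xX v + xi v ∧ xX v - xi v < 6 * M + 6 := by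
  rcases mem_rotTriV_iff.1 hv with rfl | rfl | ⟨-, h2, h3⟩
  · rw [xi_wOut, xX_wOut]; omega
  · rw [xi_hvOrigin, xX_hvOrigin]; omega
  · omega

/-- **Completeness of the exit classes of `T_M`, every `M`**: a half-edge from a vertex of `T_M ∖ {a⁻}` to a lattice
neighbour outside `T_M ∖ {a⁻}` is bottom-in, bottom-out, side-`ε`, side-`β`, the closing half-edge at `a⁻`, or the stub
below `a⁺` (in particular there are no downward side exits).  The planner's sketch checks `T_1`, `T_2` by `decide`; this is
the general statement, by the edge arithmetic `(Δξ, ΔX) ∈ {(0, ±2), (±1, ±1)}` and the parity `X ≡ ξ (mod 2)`.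
[cite: GlazmanManolescu2019, §4.1 (T_L); Beaton2014RotatedHoneycomb, §2.2 (∂D = α^{O} ∪ α^{I} ∪ ε ∪ β) and Proposition 4] -/
theorem rotTri_exit_classes {M : ℕ} {v w : HV}
    (hv : v ∈ (rotTriV M).erase wOut) (hadj : hvGraph.Adj v w) (hw : w ∉ (rotTriV M).erase wOut) :
    IsRotBotIn (v, w) ∨ IsRotBotOut (v, w) ∨ IsRotSideEps M (v, w) ∨ IsRotSideBeta M (v, w) ∨
      IsRotCloseDart (v, w) ∨ IsRotStubDart (v, w) := by
  by_cases hwo : w = wOut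
  · exact Or.inr (Or.inr (Or.inr (Or.inr (Or.inl hwo))))
  rw [mem_erase, mem_rotTriV_iff] at hv hw
  simp only [ne_eq, hwo, not_false_eq_true, true_and, false_or, not_or, not_and, not_lt] at hw
  obtain ⟨hwO, hwc⟩ := hw
  have hpv := xX_add_xi_even v
  have hpw := xX_add_xi_even w
  obtain ⟨hvne, rfl | rfl | ⟨hv1, hv2, hv3⟩⟩ := hv
  · exact absurd rfl hvne
  · -- from `a⁺`: the three neighbours are `a⁻` (excluded), the stub `(0,0,true)`, and `(-1,0,true)` (outside only if `M = 0`)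
    obtain ⟨a, b, c⟩ := w
    have h := hadj
    cases c <;> simp [hvGraph_adj, AdjRel, hvOrigin] at h
    rcases h with ⟨rfl, rfl⟩ | ⟨rfl, rfl⟩ | ⟨rfl, rfl⟩
    · exact Or.inr (Or.inr (Or.inr (Or.inr (Or.inr rfl))))
    · -- `(-1, 0, true)`: `ξ = -1`, `X = 5`; outside forces `M = 0`, and then it is a `β` exit through the right line
      have h3 := hwc (by simp [xi]) (by simp [xi, xX]; omega)
      simp only [xi, xX, bit_true] at h3
      refine Or.inr (Or.inr (Or.inr (Or.inl ⟨Or.inr ?_, ?_⟩))) <;> simp [xi, xX, hvOrigin]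
      omega
    · exact absurd rfl hwo
  · -- from an inner vertex
    rcases xi_xX_adj hadj with ⟨hξ, hX | hX⟩ | ⟨hξ | hξ, hX | hX⟩ <;>
    simp only [IsRotBotIn, IsRotBotOut, IsRotBotDart, IsRotSideEps, IsRotSideBeta, IsRotSideDart, ne_eq, hwO, hwo,
      not_false_eq_true, and_true] at hwc ⊢ <;>
    (by_cases h0 : xi w = 0
     · -- arrival on `ℓ`: a bottom dart, in or out by `|X - 3|`
       rcases abs_cases (xX v - 3) with ⟨hq, hqs⟩ | ⟨hq, hqs⟩ <;>
       rcases abs_cases (xX w - 3) with ⟨hq', hqs'⟩ | ⟨hq', hqs'⟩ <;>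
       simp only [hq, hq'] <;> omega
     · have h4 := hwc (by omega)
       omega)

/-- **Exclusivity** of the six classes on darts `(v, w)` (bottom / side / stub / close are separated by `ξ w`, `X w`,
and `ε`/`β` by `Δξ`). [cite: Beaton2014RotatedHoneycomb, §2.2] -/
theorem rotTri_classes_disjoint (M : ℕ) (v w : HV) :
    (IsRotBotIn (v, w) → ¬ IsRotBotOut (v, w)) ∧ (IsRotBotDart (v, w) → ¬ IsRotSideDart M (v, w)) ∧
    (IsRotBotDart (v, w) → ¬ IsRotCloseDart (v, w)) ∧ (IsRotBotDart (v, w) → ¬ IsRotStubDart (v, w)) ∧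
    (IsRotSideEps M (v, w) → ¬ IsRotSideBeta M (v, w)) ∧
    (IsRotSideDart M (v, w) → ¬ IsRotCloseDart (v, w)) ∧ (IsRotSideDart M (v, w) → ¬ IsRotStubDart (v, w)) ∧
    (IsRotCloseDart (v, w) → ¬ IsRotStubDart (v, w)) := by
  have hstub : ∀ {v w : HV}, IsRotStubDart (v, w) → xi w = 1 ∧ xX w = 5 := by
    intro v w h
    simp only [IsRotStubDart, Prod.mk.injEq] at h
    rw [h.2, xi_stub]; simp [xX]
  have hclose : ∀ {v w : HV}, IsRotCloseDart (v, w) → xi w = 0 ∧ xX w = 2 := by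
    intro v w h
    simp only [IsRotCloseDart] at h
    rw [h, xi_wOut, xX_wOut]; simp
  refine ⟨?_, ?_, ?_, ?_, ?_, ?_, ?_, ?_⟩
  · rintro ⟨-, h1⟩ ⟨-, h2⟩; exact lt_asymm h1 h2
  · rintro ⟨h1, h2, -, -⟩ (h | h) <;> have := xX_sub_three_emod w <;> simp only at h1 h2 h <;> omega
  · rintro ⟨-, -, -, h2⟩ h; exact h2 h
  · rintro ⟨h1, h2, -, -⟩ h; have := hstub h; simp only at h2; omega
  · rintro ⟨-, h1⟩ ⟨-, h2⟩; simp only at h1 h2; omega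
  · rintro (h | h) h' <;> have := hclose h' <;> simp only at h <;> omega
  · rintro (h | h) h' <;> have := hstub h' <;> simp only at h <;> omega
  · intro h1 h2
    simp only [IsRotCloseDart, IsRotStubDart, Prod.mk.injEq] at h1 h2
    rw [h1] at h2
    exact absurd h2.2 (by decide)

/-- **Each class consists of exit darts of `T_M`**: if `(v, w)` is in one of the six classes then `w ∉ T_M ∖ {a⁻}`.
[cite: GlazmanManolescu2019, §4.1 (T_L); Beaton2014RotatedHoneycomb, §2.2] -/
theorem not_mem_rotTriV_of_class {M : ℕ} {v w : HV}
    (hcls : IsRotBotIn (v, w) ∨ IsRotBotOut (v, w) ∨ IsRotSideEps M (v, w) ∨ IsRotSideBeta M (v, w) ∨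
      IsRotCloseDart (v, w) ∨ IsRotStubDart (v, w)) :
    w ∉ (rotTriV M).erase wOut := by
  rw [mem_erase, mem_rotTriV_iff, not_and_or, not_or, not_or]
  rcases hcls with ⟨⟨-, h0, h1, h2⟩, -⟩ | ⟨⟨-, h0, h1, h2⟩, -⟩ | ⟨h | h, -⟩ | ⟨h | h, -⟩ | h | h
  · simp only at h0 h1 h2
    exact Or.inr ⟨h2, h1, fun h' => by omega⟩
  · simp only at h0 h1 h2
    exact Or.inr ⟨h2, h1, fun h' => by omega⟩
  · simp only at h
    refine Or.inr ⟨fun e => ?_, fun e => ?_, fun h' => by omega⟩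
    · rw [e, xi_wOut, xX_wOut] at h; omega
    · rw [e, xi_hvOrigin, xX_hvOrigin] at h; omega
  · simp only at h
    refine Or.inr ⟨fun e => ?_, fun e => ?_, fun h' => by omega⟩
    · rw [e, xi_wOut, xX_wOut] at h; omega
    · rw [e, xi_hvOrigin, xX_hvOrigin] at h; omega
  · simp only at h
    refine Or.inr ⟨fun e => ?_, fun e => ?_, fun h' => by omega⟩
    · rw [e, xi_wOut, xX_wOut] at h; omega
    · rw [e, xi_hvOrigin, xX_hvOrigin] at h; omega
  · simp only at h
    refine Or.inr ⟨fun e => ?_, fun e => ?_, fun h' => by omega⟩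
    · rw [e, xi_wOut, xX_wOut] at h; omega
    · rw [e, xi_hvOrigin, xX_hvOrigin] at h; omega
  · left; simp only [IsRotCloseDart] at h; simp [h]
  · simp only [IsRotStubDart, Prod.mk.injEq] at h
    rw [h.2]
    refine Or.inr ⟨by decide, by decide, fun h' => ?_⟩
    rw [xi_stub] at h'; omega

/-- **The exit condition is membership in one of the six classes** (darts out of `T_M ∖ {a⁻}` along an edge of `ℍ`).
[cite: GlazmanManolescu2019, §4.1 (T_L); Beaton2014RotatedHoneycomb, §2.2 and Proposition 4] -/
theorem rotTri_exit_iff {M : ℕ} {v w : HV} (hv : v ∈ (rotTriV M).erase wOut) (hadj : hvGraph.Adj v w) :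
    w ∉ (rotTriV M).erase wOut ↔
      (IsRotBotIn (v, w) ∨ IsRotBotOut (v, w) ∨ IsRotSideEps M (v, w) ∨ IsRotSideBeta M (v, w) ∨
        IsRotCloseDart (v, w) ∨ IsRotStubDart (v, w)) :=
  ⟨rotTri_exit_classes hv hadj, not_mem_rotTriV_of_class⟩

/-- Sanity against the planner's `decide` instances: the general lemma specialises to `T_2`.
[cite: GlazmanManolescu2019, §4.1 (T_L)] -/
example {v w : HV} (hv : v ∈ (rotTriV 2).erase wOut) (hadj : hvGraph.Adj v w) (hw : w ∉ (rotTriV 2).erase wOut) :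
    IsRotBotIn (v, w) ∨ IsRotBotOut (v, w) ∨ IsRotSideEps 2 (v, w) ∨ IsRotSideBeta 2 (v, w) ∨
      IsRotCloseDart (v, w) ∨ IsRotStubDart (v, w) :=
  rotTri_exit_classes hv hadj hw

/-! ### The tilted Hopf evaluation behind the two sides of `T_M` -/

/-- `Im(edir y x) = (X x - X y) · √3/2` (the tree's abscissa is Beaton's `X`). [folklore] -/
private theorem im_edir' (y x : HV) : (edir y x).im = ((xX x : ℝ) - xX y) * (Real.sqrt 3 / 2) := by
  rw [edir, emb_im, Prod.snd_sub, pos_snd_eq, pos_snd_eq]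
  push_cast
  ring

/-- `Re(edir y x) = (3/2)(ξ x - ξ y)`. [folklore] -/
private theorem re_edir' (y x : HV) : (edir y x).re = (3 / 2 : ℝ) * (xi x - xi y) := by
  have h := im_negI_mul_edir y x
  rw [neg_mul, Complex.neg_im, Complex.I_mul_im] at h
  linarith

/-- **The right tilt**: `Im(-I·ω · edir y x) = (3/4)·((X x - ξ x) - (X y - ξ y))` — the level sets of `X - ξ` are the
lines parallel to the right side of `T_M`. [cite: GlazmanManolescu2019, §4.1 (the sides of T_L)] -/
theorem im_negI_omg_mul_edir (y x : HV) :
    (-I * omg * edir y x).im = (3 / 4 : ℝ) * (((xX x : ℝ) - xi x) - ((xX y : ℝ) - xi y)) := by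
  have hre := re_edir' y x
  have him := im_edir' y x
  have h3 : Real.sqrt 3 * Real.sqrt 3 = 3 := Real.mul_self_sqrt (by norm_num)
  rw [Complex.mul_im, Complex.mul_re, Complex.mul_im, Complex.neg_re, Complex.neg_im, Complex.I_re, Complex.I_im,
    omg_re, omg_im, hre, him]
  linear_combination (((xX x : ℝ) - xX y) / 4) * h3

/-- **The left tilt**: `Im(I·ω² · edir y x) = (3/4)·((X y + ξ y) - (X x + ξ x))` — the level sets of `X + ξ` are the
lines parallel to the left side of `T_M`. [cite: GlazmanManolescu2019, §4.1 (the sides of T_L)] -/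
theorem im_I_omgsq_mul_edir (y x : HV) :
    (I * omg ^ 2 * edir y x).im = (3 / 4 : ℝ) * (((xX y : ℝ) + xi y) - ((xX x : ℝ) + xi x)) := by
  have hre := re_edir' y x
  have him := im_edir' y x
  have h3 : Real.sqrt 3 * Real.sqrt 3 = 3 := Real.mul_self_sqrt (by norm_num)
  rw [omg_sq, Complex.mul_im, Complex.mul_re, Complex.mul_im, Complex.sub_re, Complex.sub_im, Complex.I_re, Complex.I_im,
    omg_re, omg_im, Complex.one_re, Complex.one_im, hre, him]
  linear_combination (-((xX x : ℝ) - xX y) / 4) * h3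

/-- **No wrap under a `π/3` tilt**: if `w ≠ 0` and both `w` and `ω·w` lie in the closed upper half-plane then
`arg(ω w) = arg w + π/3` (the tree's `arg_mul_eq_add_of_im_nonneg` with `c = ω`). [folklore] -/
private theorem arg_omg_mul_of_im_nonneg {w : ℂ} (hw : w ≠ 0) (h0 : 0 ≤ w.im) (h1 : 0 ≤ (omg * w).im) :
    Complex.arg (omg * w) = Complex.arg w + π / 3 := by
  rw [arg_mul_eq_add_of_im_nonneg omg_ne_zero hw (by rw [omg_im]; positivity)
    (by rw [arg_omg]; linarith [Real.pi_pos]) h0 h1, arg_omg, add_comm]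

/-- `-I · e₀ = √3` (the first dart `a⁻ → a⁺` is the positive real direction of Beaton's frame). [folklore] -/
private theorem negI_mul_e0 : -I * emb (-1, 2) = (Real.sqrt 3 : ℂ) := by
  rw [emb_neg_one_two]; ring_nf; rw [Complex.I_sq]; ring

/-- `arg(-I · e₀) = 0`. [folklore] -/
private theorem arg_negI_mul_e0 : Complex.arg (-I * emb (-1, 2)) = 0 := by
  rw [negI_mul_e0, Complex.arg_ofReal_of_nonneg (Real.sqrt_nonneg 3)]

/-- `-I · emb(-2, 1) = √3 · ω` (the NE edge). [folklore] -/
private theorem negI_mul_emb_NE : -I * emb (-2, 1) = (Real.sqrt 3 : ℂ) * omg := by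
  apply Complex.ext
  · rw [Complex.mul_re, Complex.neg_re, Complex.neg_im, Complex.I_re, Complex.I_im, emb_re, emb_im,
      Complex.re_ofReal_mul, omg_re]
    push_cast
    ring
  · rw [Complex.mul_im, Complex.neg_re, Complex.neg_im, Complex.I_re, Complex.I_im, emb_re, emb_im,
      Complex.im_ofReal_mul, omg_im]
    push_cast
    have h3 : Real.sqrt 3 * Real.sqrt 3 = 3 := Real.mul_self_sqrt (by norm_num)
    nlinarith [h3]

/-- `-I · emb(-1, -1) = √3 · ω²` (the NW edge). [folklore] -/
private theorem negI_mul_emb_NW : -I * emb (-1, -1) = (Real.sqrt 3 : ℂ) * omg ^ 2 := by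
  rw [omg_sq]
  apply Complex.ext
  · rw [Complex.mul_re, Complex.neg_re, Complex.neg_im, Complex.I_re, Complex.I_im, emb_re, emb_im,
      Complex.re_ofReal_mul, Complex.sub_re, omg_re, Complex.one_re]
    push_cast
    ring
  · rw [Complex.mul_im, Complex.neg_re, Complex.neg_im, Complex.I_re, Complex.I_im, emb_re, emb_im,
      Complex.im_ofReal_mul, Complex.sub_im, omg_im, Complex.one_im]
    push_cast
    have h3 : Real.sqrt 3 * Real.sqrt 3 = 3 := Real.mul_self_sqrt (by norm_num)
    nlinarith [h3]

section TiltedHopf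

variable {M : ℕ} {l : List HV} {u : HV}

/-- Common anatomy of a right-started walk of `T_M ∖ {a⁻}` to an outer vertex `u ∉ T_M` with `ξ u ≤ 0`: the list
`a⁻ :: (l ++ [u])` is duplicate-free, and every entry `x` has `ξ x ≤ 0`, `-6M ≤ X x + ξ x … ` (precisely: `x ∈ T_M` or `x = u`).
[cite: GlazmanManolescu2019, §4.1 (T_L)] -/
private theorem walk_anatomy (hl : l ≠ []) (hP : IsMidWalk ((rotTriV M).erase wOut) (wOut :: (l ++ [u])))
    (huT : u ∉ rotTriV M) :
    (wOut :: (l ++ [u])).Nodup ∧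
      ∀ i ≤ l.length + 1, (wOut :: (l ++ [u])).getD i hvOrigin ∈ rotTriV M ∨ (wOut :: (l ++ [u])).getD i hvOrigin = u := by
  obtain ⟨-, -, -, hlV, hnd, -⟩ := (isMidWalk_cons_append_iff _ hl u).1 hP
  have hwl : wOut ∉ l := fun h => (mem_erase.1 (hlV _ h)).1 rfl
  have hul : u ∉ l := fun h => huT (mem_of_mem_erase (hlV u h))
  have huw : u ≠ wOut := fun h => huT (h ▸ mem_insert_self _ _)
  refine ⟨?_, fun i hi => ?_⟩
  · rw [List.nodup_cons, List.mem_append, List.mem_singleton, not_or]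
    exact ⟨⟨hwl, Ne.symm huw⟩, hnd.append (List.nodup_singleton u) (List.disjoint_singleton.2 hul)⟩
  · rcases getD_walk_mem hi u with h | h | h
    · left; rw [h]; exact mem_insert_self _ _
    · left; exact mem_of_mem_erase (hlV _ h)
    · exact Or.inr h

/-- **Tilted Hopf, right side.** For a right-started self-avoiding walk `a⁻ :: (l ++ [u])` of `T_M ∖ {a⁻}` whose exit
vertex `u` lies ON the right side line `X - ξ = 6M + 6` with `ξ u ≤ 0`: `(π/3)·pturn = arg(-Iω · t₁) - π/3`, `t₁` the exit
edge vector — Hopf with `c₁ = -I` (the walk lies in `{ξ ≤ 0}` above `a⁻`) and `c₂ = -I·ω` (the walk lies in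
`{X - ξ ≤ 6M + 6}` behind the right side); the two chord terms differ by exactly `π/3` (`arg_omg_mul_of_im_nonneg`).
[cite: GlazmanManolescu2019, §4.1 (T_L); DuminilCopinSmirnov2012, proof of Lemma 2 (Hopf)] -/
theorem hopf_rotTri_right (hl : l ≠ []) (hP : IsMidWalk ((rotTriV M).erase wOut) (wOut :: (l ++ [u])))
    (hu : xX u - xi u = 6 * M + 6) (hξu : xi u ≤ 0) :
    (π / 3) * pturn (wOut :: (l ++ [u])) = Complex.arg (-I * omg * edir (l.getLast hl) u) - π / 3 := by
  have huT : u ∉ rotTriV M := fun h => by have := (tilt_bounds_of_mem_rotTriV h).2; omega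
  obtain ⟨hPnd, hentry⟩ := walk_anatomy hl hP huT
  obtain ⟨-, hh, -, -, -, -⟩ := (isMidWalk_cons_append_iff _ hl u).1 hP
  have hlen : (wOut :: (l ++ [u])).length = l.length + 2 := by simp
  have hnI : (-I : ℂ) ≠ 0 := neg_ne_zero.2 Complex.I_ne_zero
  have hc2 : (-I * omg : ℂ) ≠ 0 := mul_ne_zero hnI omg_ne_zero
  have e0 : edir wOut hvOrigin = emb (-1, 2) := by rw [edir, pos_hvOrigin, pos_wOut]; rfl
  -- the chord `D = a⁻ → u`
  have huw : u ≠ wOut := fun h => huT (h ▸ mem_insert_self _ _)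
  have hD0 : -I * edir wOut u ≠ 0 := mul_ne_zero hnI (edir_ne_zero_of_ne (Ne.symm huw))
  have hDim : 0 ≤ (-I * edir wOut u).im := by
    rw [im_negI_mul_edir, xi_wOut]
    have : (xi u : ℝ) ≤ 0 := by exact_mod_cast hξu
    nlinarith
  have hDim2 : 0 ≤ (omg * (-I * edir wOut u)).im := by
    rw [show omg * (-I * edir wOut u) = -I * omg * edir wOut u by ring, im_negI_omg_mul_edir, xi_wOut, xX_wOut]
    have : ((xX u : ℝ) - xi u) = 6 * M + 6 := by exact_mod_cast hu
    push_cast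
    nlinarith
  have hchord : Complex.arg (-I * omg * edir wOut u) = Complex.arg (-I * edir wOut u) + π / 3 := by
    rw [show -I * omg * edir wOut u = omg * (-I * edir wOut u) by ring]
    exact arg_omg_mul_of_im_nonneg hD0 hDim hDim2
  have key := hopf_path_eval hP.1 hPnd hlen hnI hc2 ?_ ?_
  · rw [getD_walk_last, getD_walk_prev hl, List.getD_cons_zero, getD_walk_one hh, e0, arg_negI_mul_e0, hchord] at key
    linarith
  · -- `h₁`: `ξ ≤ 0` along the walk
    intro i hi
    rw [List.getD_cons_zero, im_negI_mul_edir, xi_wOut]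
    have : xi ((wOut :: (l ++ [u])).getD i hvOrigin) ≤ 0 := by
      rcases hentry i hi with h | h
      · exact xi_le_zero_of_mem_rotTriV h
      · rw [h]; exact hξu
    have : (xi ((wOut :: (l ++ [u])).getD i hvOrigin) : ℝ) ≤ 0 := by exact_mod_cast this
    nlinarith
  · -- `h₂`: `X - ξ ≤ 6M + 6` along the walk
    intro i hi
    rw [getD_walk_last, im_negI_omg_mul_edir]
    have : xX ((wOut :: (l ++ [u])).getD i hvOrigin) - xi ((wOut :: (l ++ [u])).getD i hvOrigin) ≤ xX u - xi u := by
      rcases hentry i hi with h | h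
      · have := (tilt_bounds_of_mem_rotTriV h).2; omega
      · rw [h]
    have : ((xX ((wOut :: (l ++ [u])).getD i hvOrigin) : ℝ) - xi ((wOut :: (l ++ [u])).getD i hvOrigin)) ≤
        (xX u : ℝ) - xi u := by exact_mod_cast this
    nlinarith

/-- **Tilted Hopf, left side.** Same with `u` ON the left side line `X + ξ = -6M`: `(π/3)·pturn = arg(Iω² · t₁) + π/3`
(`c₂ = I·ω² = -I·ω̄`; the walk lies in `{X + ξ ≥ -6M}`). [cite: GlazmanManolescu2019, §4.1 (T_L); DuminilCopinSmirnov2012, proof of Lemma 2 (Hopf)] -/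
theorem hopf_rotTri_left (hl : l ≠ []) (hP : IsMidWalk ((rotTriV M).erase wOut) (wOut :: (l ++ [u])))
    (hu : xX u + xi u = -(6 : ℤ) * M) (hξu : xi u ≤ 0) :
    (π / 3) * pturn (wOut :: (l ++ [u])) = Complex.arg (I * omg ^ 2 * edir (l.getLast hl) u) + π / 3 := by
  have huT : u ∉ rotTriV M := fun h => by have := (tilt_bounds_of_mem_rotTriV h).1; omega
  obtain ⟨hPnd, hentry⟩ := walk_anatomy hl hP huT
  obtain ⟨-, hh, -, -, -, -⟩ := (isMidWalk_cons_append_iff _ hl u).1 hP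
  have hlen : (wOut :: (l ++ [u])).length = l.length + 2 := by simp
  have hnI : (-I : ℂ) ≠ 0 := neg_ne_zero.2 Complex.I_ne_zero
  have hc2 : (I * omg ^ 2 : ℂ) ≠ 0 := mul_ne_zero Complex.I_ne_zero (pow_ne_zero _ omg_ne_zero)
  have e0 : edir wOut hvOrigin = emb (-1, 2) := by rw [edir, pos_hvOrigin, pos_wOut]; rfl
  have huw : u ≠ wOut := fun h => huT (h ▸ mem_insert_self _ _)
  have hD0 : I * omg ^ 2 * edir wOut u ≠ 0 := mul_ne_zero hc2 (edir_ne_zero_of_ne (Ne.symm huw))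
  have hDim : 0 ≤ (I * omg ^ 2 * edir wOut u).im := by
    rw [im_I_omgsq_mul_edir, xi_wOut, xX_wOut]
    have : ((xX u : ℝ) + xi u) = -(6 * M) := by exact_mod_cast (by omega : xX u + xi u = -(6 * M))
    push_cast
    nlinarith
  have hDim2 : 0 ≤ (omg * (I * omg ^ 2 * edir wOut u)).im := by
    rw [show omg * (I * omg ^ 2 * edir wOut u) = I * omg ^ 3 * edir wOut u by ring, omg_pow_three,
      show I * (-1) * edir wOut u = -I * edir wOut u by ring, im_negI_mul_edir, xi_wOut]
    have : (xi u : ℝ) ≤ 0 := by exact_mod_cast hξu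
    nlinarith
  have hchord : Complex.arg (-I * edir wOut u) = Complex.arg (I * omg ^ 2 * edir wOut u) + π / 3 := by
    rw [show -I * edir wOut u = omg * (I * omg ^ 2 * edir wOut u) by
      rw [show omg * (I * omg ^ 2 * edir wOut u) = I * omg ^ 3 * edir wOut u by ring, omg_pow_three]; ring]
    exact arg_omg_mul_of_im_nonneg hD0 hDim hDim2
  have key := hopf_path_eval hP.1 hPnd hlen hnI hc2 ?_ ?_
  · rw [getD_walk_last, getD_walk_prev hl, List.getD_cons_zero, getD_walk_one hh, e0, arg_negI_mul_e0, hchord] at key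
    linarith
  · intro i hi
    rw [List.getD_cons_zero, im_negI_mul_edir, xi_wOut]
    have : xi ((wOut :: (l ++ [u])).getD i hvOrigin) ≤ 0 := by
      rcases hentry i hi with h | h
      · exact xi_le_zero_of_mem_rotTriV h
      · rw [h]; exact hξu
    have : (xi ((wOut :: (l ++ [u])).getD i hvOrigin) : ℝ) ≤ 0 := by exact_mod_cast this
    nlinarith
  · intro i hi
    rw [getD_walk_last, im_I_omgsq_mul_edir]
    have : xX u + xi u ≤ xX ((wOut :: (l ++ [u])).getD i hvOrigin) + xi ((wOut :: (l ++ [u])).getD i hvOrigin) := by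
      rcases hentry i hi with h | h
      · have := (tilt_bounds_of_mem_rotTriV h).1; omega
      · rw [h]
    have : ((xX u : ℝ) + xi u) ≤
        (xX ((wOut :: (l ++ [u])).getD i hvOrigin) : ℝ) + xi ((wOut :: (l ++ [u])).getD i hvOrigin) := by
      exact_mod_cast this
    nlinarith

end TiltedHopf

/-! ### Windings of the side exits of `T_M` -/

/-- The orientation of a side exit follows the side: an `ε` exit through the right line increases `X` (by `2`), through the
left line decreases it; a `β` exit through the right line is NE (`ΔX = +1`), through the left line NW — because the start
vertex is inside.  Stated as: `X u > 3` iff the right line. [cite: GlazmanManolescu2019, §4.1 (T_L)] -/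
theorem side_iff_right {M : ℕ} {v u : HV} (hv : v ∈ (rotTriV M).erase wOut) (hadj : hvGraph.Adj v u)
    (hside : IsRotSideDart M (v, u)) (hξ : xi u = xi v ∨ xi u = xi v - 1) :
    (3 < xX u ↔ xX u = 6 * M + 6 + xi u) ∧ (3 < xX u → xX v < xX u) ∧ (¬ 3 < xX u → xX u < xX v) := by
  have hpv := xX_add_xi_even v
  have hpu := xX_add_xi_even u
  rw [mem_erase, mem_rotTriV_iff] at hv
  obtain ⟨hvne, hv⟩ := hv
  simp only [IsRotSideDart] at hside
  rcases hv with rfl | rfl | ⟨hv1, hv2, hv3⟩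
  · exact absurd rfl hvne
  · -- from `a⁺` the only side exit is `(-1,0,true)` at `M = 0`
    obtain ⟨a, b, c⟩ := u
    have h := hadj
    cases c <;> simp [hvGraph_adj, AdjRel, hvOrigin] at h
    rcases h with ⟨rfl, rfl⟩ | ⟨rfl, rfl⟩ | ⟨rfl, rfl⟩ <;> simp [xX, xi, hvOrigin] at hside hξ ⊢ <;> omega
  · rcases xi_xX_adj hadj with ⟨hξ', hX | hX⟩ | ⟨hξ' | hξ', hX | hX⟩ <;> rcases hside with h | h <;> omega

/-- **The winding to a side-`ε` exit of `T_M`**: `pturn P = 0` through the right side, `3` (`W = π`) through the left side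
— Beaton's `W* = ∓π/2` for `ε^±`, as for the lateral exits of the strip. [cite: Beaton2014RotatedHoneycomb, Proposition 4 (proof; the windings to ε^±); GlazmanManolescu2019, §4.1; DuminilCopinSmirnov2012, proof of Lemma 2 (Hopf)] -/
theorem pturn_of_isRotSideEps {M : ℕ} {P : List HV}
    (hP : IsMidWalk ((rotTriV M).erase wOut) P) (heps : IsRotSideEps M (finalDart P)) :
    pturn P = if 3 < xX (finalDart P).2 then 0 else 3 := by
  rcases hP.trivial_or_exists with rfl | ⟨l, u, hl, rfl⟩
  · exfalso
    rcases heps.1 with h | h <;>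
      simp only [finalDart, List.dropLast, List.getLast?_singleton, List.getLast?_cons_cons, Option.getD_some,
        xi_hvOrigin, xX_hvOrigin] at h <;> omega
  rw [finalDart_cons_append hl] at heps ⊢
  obtain ⟨hsd, hξ⟩ := heps
  dsimp only at hsd hξ ⊢
  have hsd' : xX u = -(6 : ℤ) * M - xi u ∨ xX u = 6 * M + 6 + xi u := hsd
  obtain ⟨-, -, hadj, hlV, -, -⟩ := (isMidWalk_cons_append_iff _ hl u).1 hP
  set v := l.getLast hl with hv
  have hvV : v ∈ (rotTriV M).erase wOut := hlV _ (List.getLast_mem hl)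
  obtain ⟨hiff, hR, hL⟩ := side_iff_right hvV hadj hsd (Or.inl hξ)
  have hξu : xi u ≤ 0 := by rw [hξ]; exact xi_le_zero_of_mem_rotTriV (mem_of_mem_erase hvV)
  have hvec := lat_exit_vector hadj hξ
  have hΔX : xX u = (if v.2.2 then xX v + 2 else xX v - 2) := by
    have e := congrArg Prod.snd hvec
    rw [Prod.snd_sub, pos_snd_eq, pos_snd_eq] at e
    split_ifs at e ⊢ <;> simp at e <;> omega
  have hπ : (0 : ℝ) < π / 3 := by positivity
  by_cases hs : 3 < xX u
  · -- right side: exit vector `e₀`, `-Iω e₀ = √3 ω`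
    rw [if_pos hs]
    have hc : v.2.2 = true := by
      by_contra hc; rw [if_neg hc] at hΔX; have := hR hs; omega
    have key := hopf_rotTri_right hl hP (by have := hiff.1 hs; omega) hξu
    have e : -I * omg * emb (-1, 2) = (Real.sqrt 3 : ℂ) * omg := by
      rw [show -I * omg * emb (-1, 2) = omg * (-I * emb (-1, 2)) by ring, negI_mul_e0]; ring
    rw [← hv, edir, hvec, if_pos hc, e, Complex.arg_real_mul _ (by positivity), arg_omg] at key
    have : (π / 3) * (pturn (wOut :: (l ++ [u])) : ℝ) = (π / 3) * (0 : ℤ) := by push_cast; linarith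
    exact_mod_cast mul_left_cancel₀ hπ.ne' this
  · -- left side: exit vector `-e₀`, `Iω² (-e₀) = √3 ω²`
    rw [if_neg hs]
    have hc : ¬ v.2.2 = true := by
      intro hc; rw [if_pos hc] at hΔX; have := hL hs; omega
    have hul : xX u + xi u = -(6 : ℤ) * M := by
      rcases hsd' with h | h
      · omega
      · exact absurd (hiff.2 h) hs
    have key := hopf_rotTri_left hl hP hul hξu
    have e : I * omg ^ 2 * emb (1, -2) = (Real.sqrt 3 : ℂ) * omg ^ 2 := by
      rw [show ((1 : ℤ), (-2 : ℤ)) = -((-1 : ℤ), (2 : ℤ)) by simp, emb_neg,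
        show I * omg ^ 2 * -emb (-1, 2) = omg ^ 2 * (-I * emb (-1, 2)) by ring, negI_mul_e0]; ring
    rw [← hv, edir, hvec, if_neg hc, e, Complex.arg_real_mul _ (by positivity), arg_omg_sq] at key
    have : (π / 3) * (pturn (wOut :: (l ++ [u])) : ℝ) = (π / 3) * (3 : ℤ) := by push_cast; linarith
    exact_mod_cast mul_left_cancel₀ hπ.ne' this

/-- **The winding to a side-`β` exit of `T_M`**: `pturn P = 1` (`W = π/3`, NE through the right side), `2` (`W = 2π/3`,
NW through the left side) — Beaton's `W* = ±π/6` for `β^±`, as for the top exits of the strip.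
[cite: Beaton2014RotatedHoneycomb, Proposition 4 (proof; the windings to β^±); GlazmanManolescu2019, §4.1; DuminilCopinSmirnov2012, proof of Lemma 2 (Hopf)] -/
theorem pturn_of_isRotSideBeta {M : ℕ} {P : List HV}
    (hP : IsMidWalk ((rotTriV M).erase wOut) P) (hbeta : IsRotSideBeta M (finalDart P)) :
    pturn P = if 3 < xX (finalDart P).2 then 1 else 2 := by
  rcases hP.trivial_or_exists with rfl | ⟨l, u, hl, rfl⟩
  · exfalso
    rcases hbeta.1 with h | h <;>
      simp only [finalDart, List.dropLast, List.getLast?_singleton, List.getLast?_cons_cons, Option.getD_some,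
        xi_hvOrigin, xX_hvOrigin] at h <;> omega
  rw [finalDart_cons_append hl] at hbeta ⊢
  obtain ⟨hsd, hξ⟩ := hbeta
  dsimp only at hsd hξ ⊢
  have hsd' : xX u = -(6 : ℤ) * M - xi u ∨ xX u = 6 * M + 6 + xi u := hsd
  obtain ⟨-, -, hadj, hlV, -, -⟩ := (isMidWalk_cons_append_iff _ hl u).1 hP
  set v := l.getLast hl with hv
  have hvV : v ∈ (rotTriV M).erase wOut := hlV _ (List.getLast_mem hl)
  obtain ⟨hiff, hR, hL⟩ := side_iff_right hvV hadj hsd (Or.inr hξ)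
  have hξu : xi u ≤ 0 := by
    rw [hξ]; have := xi_le_zero_of_mem_rotTriV (mem_of_mem_erase hvV); omega
  have hvec := top_exit_vector hadj hξ
  have hΔX : xX u = (if v.2.2 then xX v - 1 else xX v + 1) := by
    have e := congrArg Prod.snd hvec
    rw [Prod.snd_sub, pos_snd_eq, pos_snd_eq] at e
    split_ifs at e ⊢ <;> simp at e <;> omega
  have hπ : (0 : ℝ) < π / 3 := by positivity
  by_cases hs : 3 < xX u
  · -- right side: NE exit `emb(-2,1)`, `-Iω · emb(-2,1) = √3 ω²`
    rw [if_pos hs]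
    have hc : ¬ v.2.2 = true := by
      intro hc; rw [if_pos hc] at hΔX; have := hR hs; omega
    have key := hopf_rotTri_right hl hP (by have := hiff.1 hs; omega) hξu
    rw [← hv, edir, hvec, if_neg hc, show -I * omg * emb (-2, 1) = omg * (-I * emb (-2, 1)) by ring, negI_mul_emb_NE,
      show omg * ((Real.sqrt 3 : ℂ) * omg) = (Real.sqrt 3 : ℂ) * omg ^ 2 by ring,
      Complex.arg_real_mul _ (by positivity), arg_omg_sq] at key
    have : (π / 3) * (pturn (wOut :: (l ++ [u])) : ℝ) = (π / 3) * (1 : ℤ) := by push_cast; linarith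
    exact_mod_cast mul_left_cancel₀ hπ.ne' this
  · -- left side: NW exit `emb(-1,-1)`, `Iω² · emb(-1,-1) = √3 ω` (`ω⁴ = -ω`)
    rw [if_neg hs]
    have hc : v.2.2 = true := by
      by_contra hc; rw [if_neg hc] at hΔX; have := hL hs; omega
    have hul : xX u + xi u = -(6 : ℤ) * M := by
      rcases hsd' with h | h
      · omega
      · exact absurd (hiff.2 h) hs
    have key := hopf_rotTri_left hl hP hul hξu
    have e : I * omg ^ 2 * emb (-1, -1) = (Real.sqrt 3 : ℂ) * omg := by
      rw [show I * omg ^ 2 * emb (-1, -1) = -(omg ^ 2 * (-I * emb (-1, -1))) by ring, negI_mul_emb_NW,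
        show -(omg ^ 2 * ((Real.sqrt 3 : ℂ) * omg ^ 2)) = -((Real.sqrt 3 : ℂ) * omg ^ 3 * omg) by ring, omg_pow_three]
      ring
    rw [← hv, edir, hvec, if_pos hc, e, Complex.arg_real_mul _ (by positivity), arg_omg] at key
    have : (π / 3) * (pturn (wOut :: (l ++ [u])) : ℝ) = (π / 3) * (2 : ℤ) := by push_cast; linarith
    exact_mod_cast mul_left_cancel₀ hπ.ne' this

/-! ### Boundary terms of the side classes (`T(P) = edir(final) · λ^{pturn P} / e₀ · e^{-3πi/16}`) -/

/-- `Re(λ^n · e^{-3πi/16}) = cos(n θ₅ - 3π/16)`. [folklore] -/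
private theorem re_lam_zpow_mul_rotPhase' (n : ℤ) : (lam ^ n * rotPhase).re = Real.cos (n * θ₅ - 3 * π / 16) := by
  rw [lam_zpow, rotPhase, ← Complex.exp_add, ← add_mul, ← Complex.ofReal_add, Complex.exp_ofReal_mul_I_re]
  ring_nf

/-- `e₀ ≠ 0`. [folklore] -/
private theorem e0_ne_zero : emb (-1, 2) ≠ 0 := by
  rw [Ne, emb_eq_zero_iff]; simp

/-- The normalised boundary term with `edir = λ^a e₀` and `pturn = p` is `λ^{a+p} · e^{-3πi/16}`. [folklore] -/
private theorem boundaryTerm_eq' {a p : ℤ} {d : ℂ} (hd : d = lam ^ a * emb (-1, 2)) :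
    d * lam ^ p / emb (-1, 2) * rotPhase = lam ^ (a + p) * rotPhase := by
  rw [hd, zpow_add₀ lam_ne_zero]
  field_simp [e0_ne_zero]

/-- The four side exit directions as `λ`-multiples of `e₀`: `e₀ = λ⁰e₀`, `emb(-2,1) = λ⁸e₀`, `emb(-1,-1) = λ¹⁶e₀`,
`emb(1,-2) = λ²⁴e₀`. [folklore] -/
private theorem side_dirs_eq_lam_zpow :
    emb (-2, 1) = lam ^ (8 : ℤ) * emb (-1, 2) ∧ emb (-1, -1) = lam ^ (16 : ℤ) * emb (-1, 2) ∧
    emb (1, -2) = lam ^ (24 : ℤ) * emb (-1, 2) := by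
  have h8 : lam ^ (8 : ℤ) = omg := lam_zpow_eight
  have h16 : lam ^ (16 : ℤ) = omg ^ 2 := by
    rw [show (16 : ℤ) = 8 + 8 by norm_num, zpow_add₀ lam_ne_zero, h8, sq]
  have h24 : lam ^ (24 : ℤ) = -1 := by
    rw [show (24 : ℤ) = 16 + 8 by norm_num, zpow_add₀ lam_ne_zero, h16, h8, ← pow_succ, omg_pow_three]
  have e3 := omg_pow_three
  have e2 := omg_sq
  rw [h8, h16, h24]
  simp only [emb]
  push_cast
  refine ⟨?_, ?_, ?_⟩
  · linear_combination (-2 : ℂ) * e2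
  · linear_combination e2 - 2 * e3
  · ring

/-- **Side-`ε` boundary term**: `Re T = cos(3π/16)` (`λ⁰` through the right side, `λ²⁷` through the left side) —
Beaton's `c_E = 2cos(3π/16)` halved. [cite: Beaton2014RotatedHoneycomb, Proposition 4 (c_E); GlazmanManolescu2019, §4.1] -/
theorem boundaryTerm_re_of_isRotSideEps {M : ℕ} {P : List HV}
    (hP : IsMidWalk ((rotTriV M).erase wOut) P) (heps : IsRotSideEps M (finalDart P)) :
    (edir (finalDart P).1 (finalDart P).2 * lam ^ pturn P / emb (-1, 2) * rotPhase).re = Real.cos (3 * π / 16) := by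
  have hpt := pturn_of_isRotSideEps hP heps
  rcases hP.trivial_or_exists with rfl | ⟨l, u, hl, rfl⟩
  · exfalso
    rcases heps.1 with h | h <;>
      simp only [finalDart, List.dropLast, List.getLast?_singleton, List.getLast?_cons_cons, Option.getD_some,
        xi_hvOrigin, xX_hvOrigin] at h <;> omega
  rw [finalDart_cons_append hl] at heps hpt ⊢
  obtain ⟨hsd, hξ⟩ := heps
  dsimp only at hsd hξ hpt ⊢
  obtain ⟨-, -, hadj, hlV, -, -⟩ := (isMidWalk_cons_append_iff _ hl u).1 hP
  have hvV : l.getLast hl ∈ (rotTriV M).erase wOut := hlV _ (List.getLast_mem hl)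
  obtain ⟨-, hR, hL⟩ := side_iff_right hvV hadj hsd (Or.inl hξ)
  have hvec := lat_exit_vector hadj hξ
  have hΔX : xX u = (if (l.getLast hl).2.2 then xX (l.getLast hl) + 2 else xX (l.getLast hl) - 2) := by
    have e := congrArg Prod.snd hvec
    rw [Prod.snd_sub, pos_snd_eq, pos_snd_eq] at e
    split_ifs at e ⊢ <;> simp at e <;> omega
  obtain ⟨-, -, d24⟩ := side_dirs_eq_lam_zpow
  by_cases hs : 3 < xX u
  · have hc : (l.getLast hl).2.2 = true := by
      by_contra hc; rw [if_neg hc] at hΔX; have := hR hs; omega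
    rw [if_pos hs] at hpt
    rw [if_pos hc] at hvec
    rw [hpt, boundaryTerm_eq' (a := 0) (by rw [edir, hvec, zpow_zero, one_mul]), re_lam_zpow_mul_rotPhase',
      show (((0 + 0 : ℤ) : ℝ)) * θ₅ - 3 * π / 16 = -(3 * π / 16) by push_cast; ring, Real.cos_neg]
  · have hc : ¬ (l.getLast hl).2.2 = true := by
      intro hc; rw [if_pos hc] at hΔX; have := hL hs; omega
    rw [if_neg hs] at hpt
    rw [if_neg hc] at hvec
    rw [hpt, boundaryTerm_eq' (a := 24) (by rw [edir, hvec, d24]), re_lam_zpow_mul_rotPhase',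
      show (((24 + 3 : ℤ) : ℝ)) * θ₅ - 3 * π / 16 = 3 * π / 16 - ((3 : ℤ) : ℝ) * (2 * π) by rw [θ₅]; push_cast; ring,
      Real.cos_sub_int_mul_two_pi]

/-- **Side-`β` boundary term**: `Re T = cos(π/16)` (`λ⁹` NE, `λ¹⁸` NW) — Beaton's `c_B = 2cos(π/16)` halved.
[cite: Beaton2014RotatedHoneycomb, Proposition 4 (c_B); GlazmanManolescu2019, §4.1] -/
theorem boundaryTerm_re_of_isRotSideBeta {M : ℕ} {P : List HV}
    (hP : IsMidWalk ((rotTriV M).erase wOut) P) (hbeta : IsRotSideBeta M (finalDart P)) :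
    (edir (finalDart P).1 (finalDart P).2 * lam ^ pturn P / emb (-1, 2) * rotPhase).re = Real.cos (π / 16) := by
  have hpt := pturn_of_isRotSideBeta hP hbeta
  rcases hP.trivial_or_exists with rfl | ⟨l, u, hl, rfl⟩
  · exfalso
    rcases hbeta.1 with h | h <;>
      simp only [finalDart, List.dropLast, List.getLast?_singleton, List.getLast?_cons_cons, Option.getD_some,
        xi_hvOrigin, xX_hvOrigin] at h <;> omega
  rw [finalDart_cons_append hl] at hbeta hpt ⊢
  obtain ⟨hsd, hξ⟩ := hbeta
  dsimp only at hsd hξ hpt ⊢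
  obtain ⟨-, -, hadj, hlV, -, -⟩ := (isMidWalk_cons_append_iff _ hl u).1 hP
  have hvV : l.getLast hl ∈ (rotTriV M).erase wOut := hlV _ (List.getLast_mem hl)
  obtain ⟨-, hR, hL⟩ := side_iff_right hvV hadj hsd (Or.inr hξ)
  have hvec := top_exit_vector hadj hξ
  have hΔX : xX u = (if (l.getLast hl).2.2 then xX (l.getLast hl) - 1 else xX (l.getLast hl) + 1) := by
    have e := congrArg Prod.snd hvec
    rw [Prod.snd_sub, pos_snd_eq, pos_snd_eq] at e
    split_ifs at e ⊢ <;> simp at e <;> omega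
  obtain ⟨d8, d16, -⟩ := side_dirs_eq_lam_zpow
  by_cases hs : 3 < xX u
  · have hc : ¬ (l.getLast hl).2.2 = true := by
      intro hc; rw [if_pos hc] at hΔX; have := hR hs; omega
    rw [if_pos hs] at hpt
    rw [if_neg hc] at hvec
    rw [hpt, boundaryTerm_eq' (a := 8) (by rw [edir, hvec, d8]), re_lam_zpow_mul_rotPhase',
      show (((8 + 1 : ℤ) : ℝ)) * θ₅ - 3 * π / 16 = -(π / 16) - ((1 : ℤ) : ℝ) * (2 * π) by rw [θ₅]; push_cast; ring,
      Real.cos_sub_int_mul_two_pi, Real.cos_neg]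
  · have hc : (l.getLast hl).2.2 = true := by
      by_contra hc; rw [if_neg hc] at hΔX; have := hL hs; omega
    rw [if_neg hs] at hpt
    rw [if_pos hc] at hvec
    rw [hpt, boundaryTerm_eq' (a := 16) (by rw [edir, hvec, d16]), re_lam_zpow_mul_rotPhase',
      show (((16 + 2 : ℤ) : ℝ)) * θ₅ - 3 * π / 16 = π / 16 - ((2 : ℤ) : ℝ) * (2 * π) by rw [θ₅]; push_cast; ring,
      Real.cos_sub_int_mul_two_pi]

/-! ### Assembly: the triangle identity (face K95.2), right-started walks -/

section Assembly

/-- A right-started walk of `T_M ∖ {a⁻}` is a right-started walk of the strip `D(6M+2, 2M+1) ∖ {a⁻}` (so the bottom,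
closing and stub classes are read from `HexSAWRotStripClasses`). [cite: GlazmanManolescu2019, Lemma 4.1 (T_L ⊆ S_T)] -/
theorem isMidWalk_strip_of_tri {M : ℕ} {P : List HV} (hP : IsMidWalk ((rotTriV M).erase wOut) P) :
    IsMidWalk ((rotStripV (6 * M + 2) (2 * M + 1)).erase wOut) P :=
  hP.mono (erase_subset_erase _ (rotTriV_subset_rotStripV le_rfl le_rfl))

/-- The hypotheses of `boundary_sum_rot` for `V = T_M ∖ {a⁻}`: `a⁻ ∉ V`, `a⁺ ∈ V`, `ξ ≤ -1` on `V ∖ {a⁺}`.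
[cite: Beaton2014RotatedHoneycomb, §2.2 (proof of Proposition 4: the vertex set V′)] -/
theorem rotTriV_erase_hyps (M : ℕ) :
    wOut ∉ (rotTriV M).erase wOut ∧ hvOrigin ∈ (rotTriV M).erase wOut ∧
      ∀ w ∈ (rotTriV M).erase wOut, w ≠ hvOrigin → xi w ≤ -1 := by
  refine ⟨notMem_erase _ _, mem_erase.2 ⟨by decide, mem_insert_of_mem (mem_insert_self _ _)⟩, ?_⟩
  intro w hw hne
  rw [mem_erase, mem_rotTriV_iff] at hw
  obtain ⟨hw1, h | h | ⟨h, -, -⟩⟩ := hw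
  · exact absurd h hw1
  · exact absurd h hne
  · omega

/-- **The real, normalised boundary sum of `T_M`**: `Σ_{γ exits} x_c^{ℓ(γ)} · Re T(γ) = cos(3π/16)`.
[cite: Beaton2014RotatedHoneycomb, Proposition 4 (proof: "taking real parts"); GlazmanManolescu2019, §4.1] -/
theorem boundary_sum_rotTri_re (M : ℕ) :
    ∑ P ∈ (midWalks ((rotTriV M).erase wOut)).filter
        (fun P => P ≠ [wOut, hvOrigin] ∧ (finalDart P).2 ∉ (rotTriV M).erase wOut),
      hexCriticalFugacity ^ mwLen P *
        (edir (finalDart P).1 (finalDart P).2 * lam ^ pturn P / emb (-1, 2) * rotPhase).re =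
      Real.cos (3 * π / 16) := by
  obtain ⟨hw, hO, hξ⟩ := rotTriV_erase_hyps M
  have h := boundary_sum_rot hw hO hξ
  have e0 : edir wOut hvOrigin = emb (-1, 2) := by rw [edir, pos_hvOrigin, pos_wOut]; rfl
  rw [e0] at h
  have hne := e0_ne_zero
  have h2 : ∑ P ∈ (midWalks ((rotTriV M).erase wOut)).filter
      (fun P => P ≠ [wOut, hvOrigin] ∧ (finalDart P).2 ∉ (rotTriV M).erase wOut),
      edir (finalDart P).1 (finalDart P).2 * pwt P * (rotPhase / emb (-1, 2)) = rotPhase := by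
    rw [← Finset.sum_mul, h]; field_simp
  have h3 := congrArg Complex.re h2
  rw [Complex.re_sum] at h3
  have hre : rotPhase.re = Real.cos (3 * π / 16) := by
    rw [rotPhase, Complex.exp_ofReal_mul_I_re, Real.cos_neg]
  rw [hre] at h3
  rw [← h3]
  refine sum_congr rfl fun P _ => ?_
  rw [pwt, show edir (finalDart P).1 (finalDart P).2 * ((hexCriticalFugacity : ℂ) ^ mwLen P * lam ^ pturn P) *
      (rotPhase / emb (-1, 2)) = ((hexCriticalFugacity ^ mwLen P : ℝ) : ℂ) *
      (edir (finalDart P).1 (finalDart P).2 * lam ^ pturn P / emb (-1, 2) * rotPhase) by push_cast; ring,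
    Complex.re_ofReal_mul]

/-- The stub walk is a right-started walk of `T_M ∖ {a⁻}`. [cite: Beaton2014RotatedHoneycomb, §2.2] -/
theorem stubWalk_isMidWalk_tri (M : ℕ) :
    IsMidWalk ((rotTriV M).erase wOut) [wOut, hvOrigin, ((0 : ℤ), (0 : ℤ), true)] := by
  rw [show [wOut, hvOrigin, ((0 : ℤ), (0 : ℤ), true)] = wOut :: ([hvOrigin] ++ [((0 : ℤ), (0 : ℤ), true)]) from rfl,
    isMidWalk_cons_append_iff _ (List.cons_ne_nil _ _)]
  refine ⟨List.isChain_singleton _, rfl, ?_, ?_, List.nodup_singleton _, by decide⟩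
  · rw [List.getLast_singleton, hvGraph_adj]; simp [AdjRel, hvOrigin]
  · intro x hx
    rw [List.mem_singleton] at hx
    subst hx
    exact (rotTriV_erase_hyps M).2.1

/-- The stub class of `T_M` consists of the stub walk alone. [cite: Beaton2014RotatedHoneycomb, §2.2] -/
theorem filter_isRotStubDart_tri (M : ℕ) :
    (midWalks ((rotTriV M).erase wOut)).filter (fun P => IsRotStubDart (finalDart P)) =
      {[wOut, hvOrigin, ((0 : ℤ), (0 : ℤ), true)]} := by
  ext P
  simp only [mem_filter, mem_singleton, mem_midWalks_iff]
  constructor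
  · rintro ⟨hP, hst⟩; exact eq_stubWalk_of_isRotStubDart (isMidWalk_strip_of_tri hP) hst
  · rintro rfl; exact ⟨stubWalk_isMidWalk_tri M, rfl⟩

/-- Walks of `T_M ∖ {a⁻}` that do not exit are in no class. [cite: Beaton2014RotatedHoneycomb, §2.2] -/
theorem no_triClass_of_not_exit {M : ℕ} {P : List HV} (hP : IsMidWalk ((rotTriV M).erase wOut) P)
    (h : ¬ (P ≠ [wOut, hvOrigin] ∧ (finalDart P).2 ∉ (rotTriV M).erase wOut)) :
    ¬ IsRotBotIn (finalDart P) ∧ ¬ IsRotBotOut (finalDart P) ∧ ¬ IsRotSideEps M (finalDart P) ∧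
      ¬ IsRotSideBeta M (finalDart P) ∧ ¬ IsRotCloseDart (finalDart P) ∧ ¬ IsRotStubDart (finalDart P) := by
  rcases not_and_or.1 h with h | h
  · have ht : P = [wOut, hvOrigin] := not_ne_iff.1 h
    subst ht
    rw [finalDart_trivial]
    refine ⟨?_, ?_, ?_, ?_, ?_, ?_⟩
    · simp [IsRotBotIn, IsRotBotDart, xi_wOut]
    · simp [IsRotBotOut, IsRotBotDart, xi_wOut]
    · simp only [IsRotSideEps, IsRotSideDart, xi_hvOrigin, xX_hvOrigin]; omega
    · simp only [IsRotSideBeta, IsRotSideDart, xi_hvOrigin, xX_hvOrigin]; omega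
    · simp [IsRotCloseDart, hvOrigin, wOut]
    · simp [IsRotStubDart, hvOrigin, wOut]
  · have hw : (finalDart P).2 ∈ (rotTriV M).erase wOut := not_not.1 h
    have hnc := fun hcls => not_mem_rotTriV_of_class (M := M) (v := (finalDart P).1) (w := (finalDart P).2) hcls hw
    refine ⟨fun h1 => hnc (Or.inl h1), fun h2 => hnc (Or.inr (Or.inl h2)),
      fun h3 => hnc (Or.inr (Or.inr (Or.inl h3))), fun h4 => hnc (Or.inr (Or.inr (Or.inr (Or.inl h4)))),
      fun h5 => hnc (Or.inr (Or.inr (Or.inr (Or.inr (Or.inl h5))))),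
      fun h6 => hnc (Or.inr (Or.inr (Or.inr (Or.inr (Or.inr h6)))))⟩

/-- **Sorting one exit term of `T_M` into its class**: `[P exits] · x_c^ℓ · Re T(P)` equals the sum over the six classes of
`[finalDart P ∈ class] · x_c^ℓ · c_class`, `c = cos(3π/16), cos(π/16), cos(5π/16), cos(7π/16), cos(7π/16), cos(5π/16)` for
side-`ε`, side-`β`, `α^O`, `α^I`, close, stub. [cite: Beaton2014RotatedHoneycomb, Proposition 4 (proof); GlazmanManolescu2019, §4.1] -/
theorem triExitTerm_eq_classTerms {M : ℕ} {P : List HV} (hP : IsMidWalk ((rotTriV M).erase wOut) P) :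
    (if P ≠ [wOut, hvOrigin] ∧ (finalDart P).2 ∉ (rotTriV M).erase wOut then
        hexCriticalFugacity ^ mwLen P *
          (edir (finalDart P).1 (finalDart P).2 * lam ^ pturn P / emb (-1, 2) * rotPhase).re
      else 0) =
      (if IsRotSideEps M (finalDart P) then hexCriticalFugacity ^ mwLen P * Real.cos (3 * π / 16) else 0) +
      (if IsRotSideBeta M (finalDart P) then hexCriticalFugacity ^ mwLen P * Real.cos (π / 16) else 0) +
      (if IsRotBotOut (finalDart P) then hexCriticalFugacity ^ mwLen P * Real.cos (5 * π / 16) else 0) +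
      (if IsRotBotIn (finalDart P) then hexCriticalFugacity ^ mwLen P * Real.cos (7 * π / 16) else 0) +
      (if IsRotCloseDart (finalDart P) then hexCriticalFugacity ^ mwLen P * Real.cos (7 * π / 16) else 0) +
      (if IsRotStubDart (finalDart P) then hexCriticalFugacity ^ mwLen P * Real.cos (5 * π / 16) else 0) := by
  have hP' := isMidWalk_strip_of_tri hP
  by_cases hq : P ≠ [wOut, hvOrigin] ∧ (finalDart P).2 ∉ (rotTriV M).erase wOut
  · rw [if_pos hq]
    obtain ⟨hne, hw⟩ := hq
    have hv : (finalDart P).1 ∈ (rotTriV M).erase wOut := finalDart_fst_mem hP hne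
    have hcls := rotTri_exit_classes hv hP.adj_finalDart hw
    obtain ⟨d1, d2, d3, d4, d5, d6, d7, d8⟩ := rotTri_classes_disjoint M (finalDart P).1 (finalDart P).2
    rcases hcls with h | h | h | h | h | h
    · -- `α^I`
      have hb : IsRotBotDart (finalDart P) := h.1
      rw [boundaryTerm_re_of_isRotBotIn hP' h, if_neg (fun h' => d2 hb h'.1), if_neg (fun h' => d2 hb h'.1),
        if_neg (d1 h), if_pos h, if_neg (d3 hb), if_neg (d4 hb)]
      ring
    · -- `α^O`
      have hb : IsRotBotDart (finalDart P) := h.1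
      have hni : ¬ IsRotBotIn (finalDart P) := fun h' => d1 h' h
      rw [boundaryTerm_re_of_isRotBotOut hP' h, if_neg (fun h' => d2 hb h'.1), if_neg (fun h' => d2 hb h'.1),
        if_pos h, if_neg hni, if_neg (d3 hb), if_neg (d4 hb)]
      ring
    · -- `ε`
      have hsd : IsRotSideDart M (finalDart P) := h.1
      have hnb : ¬ IsRotBotDart (finalDart P) := fun h' => d2 h' hsd
      rw [boundaryTerm_re_of_isRotSideEps hP h, if_pos h, if_neg (d5 h), if_neg (fun h' => hnb h'.1),
        if_neg (fun h' => hnb h'.1), if_neg (d6 hsd), if_neg (d7 hsd)]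
      ring
    · -- `β`
      have hsd : IsRotSideDart M (finalDart P) := h.1
      have hnb : ¬ IsRotBotDart (finalDart P) := fun h' => d2 h' hsd
      have hne' : ¬ IsRotSideEps M (finalDart P) := fun h' => d5 h' h
      rw [boundaryTerm_re_of_isRotSideBeta hP h, if_neg hne', if_pos h, if_neg (fun h' => hnb h'.1),
        if_neg (fun h' => hnb h'.1), if_neg (d6 hsd), if_neg (d7 hsd)]
      ring
    · -- close
      have hnb : ¬ IsRotBotDart (finalDart P) := fun h' => d3 h' h
      have hns : ¬ IsRotSideDart M (finalDart P) := fun h' => d6 h' h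
      rw [boundaryTerm_re_of_isRotCloseDart hP' h, if_neg (fun h' => hns h'.1), if_neg (fun h' => hns h'.1),
        if_neg (fun h' => hnb h'.1), if_neg (fun h' => hnb h'.1), if_pos h, if_neg (d8 h)]
      ring
    · -- stub
      have hnb : ¬ IsRotBotDart (finalDart P) := fun h' => d4 h' h
      have hns : ¬ IsRotSideDart M (finalDart P) := fun h' => d7 h' h
      have hnc : ¬ IsRotCloseDart (finalDart P) := fun h' => d8 h' h
      rw [if_neg (fun h' => hns h'.1), if_neg (fun h' => hns h'.1), if_neg (fun h' => hnb h'.1),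
        if_neg (fun h' => hnb h'.1), if_neg hnc, if_pos h]
      have hP'' := eq_stubWalk_of_isRotStubDart hP' h
      subst hP''
      have hfd : finalDart [wOut, hvOrigin, ((0 : ℤ), (0 : ℤ), true)] = (hvOrigin, ((0 : ℤ), (0 : ℤ), true)) := rfl
      rw [hfd]
      dsimp only
      rw [boundaryTerm_re_stub.2]
      ring
  · rw [if_neg hq]
    obtain ⟨h1, h2, h3, h4, h5, h6⟩ := no_triClass_of_not_exit hP hq
    rw [if_neg h1, if_neg h2, if_neg h3, if_neg h4, if_neg h5, if_neg h6]
    ring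

/-- **The triangle identity (face K95.2 «ROT-TRI-IDENTITY»)**: for every `M`, with `V = T_M ∖ {a⁻}` and the right-started
generating functions at `x_c` (weight `x_c^ℓ`, `a⁻` uncounted),
`2 sin(3π/16) A^O + 2 sin(π/16) A^I + W_M + 2 cos(7π/16) P = 2 x_c cos(π/16)`,
`W_M = 2cos(3π/16) E^{side} + 2cos(π/16) B^{side}` — Beaton's Proposition 4 summed over the triangle `T_M` instead of the
strip (the sides carry the `ε`- and `β`-windings by edge type; at `M = 0` it reads `2cos(π/16)·x_c = K/2`).  Proof: the
rotated boundary sum `HV.boundary_sum_rot`, the exits sorted by `rotTri_exit_iff`, the side windings by the tilted Hopf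
evaluation, the other classes through `T_M ⊆ D(6M+2, 2M+1)`.  Printed neighbours: Beaton's Proposition 4 (the same
identity over the rotated strip) and Glazman–Manolescu's triangle identity in the UNROTATED frame, proof of Lemma 4.1:
"By summing the real part of (CR) … we obtain `cos(3π/8) A^Δ_{2L+1} + cos(π/8) D^Δ_{2L+1} = 1`". [cite: GlazmanManolescu2019, §4.1, proof of Lemma 4.1 (the triangle identity cos(3π/8)A^Δ + cos(π/8)D^Δ = 1; arXiv p. 12)] [cite: Beaton2014RotatedHoneycomb, §2.2, Proposition 4 (arXiv v3 p. 5) and its proof (pp. 5–7)] [cite: DuminilCopinSmirnov2012, Lemma 1, proof of Lemma 2 (Hopf)] -/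
theorem rotTri_identity (M : ℕ) :
    2 * Real.sin (3 * Real.pi / 16) * rotGF ((rotTriV M).erase wOut) IsRotBotOut +
      2 * Real.sin (Real.pi / 16) * rotGF ((rotTriV M).erase wOut) IsRotBotIn +
      rotTriW M + 2 * Real.cos (7 * Real.pi / 16) * rotGF ((rotTriV M).erase wOut) IsRotCloseDart =
    2 * hexCriticalFugacity * Real.cos (Real.pi / 16) := by
  have hsum := boundary_sum_rotTri_re M
  rw [sum_filter, sum_congr rfl (fun P hP => triExitTerm_eq_classTerms (mem_midWalks_iff.1 hP))] at hsum
  simp only [sum_add_distrib] at hsum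
  have hcls : ∀ (cls : HV × HV → Prop) [DecidablePred cls] (c : ℝ),
      ∑ P ∈ midWalks ((rotTriV M).erase wOut),
        (if cls (finalDart P) then hexCriticalFugacity ^ mwLen P * c else 0) =
        c * rotGF ((rotTriV M).erase wOut) cls := by
    intro cls _ c
    rw [rotGF, mul_sum, sum_filter]
    refine sum_congr rfl fun P _ => ?_
    split_ifs <;> ring
  have hstub : ∑ P ∈ midWalks ((rotTriV M).erase wOut),
      (if IsRotStubDart (finalDart P) then hexCriticalFugacity ^ mwLen P * Real.cos (5 * π / 16) else 0) =
      hexCriticalFugacity * Real.cos (5 * π / 16) := by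
    rw [← sum_filter, filter_isRotStubDart_tri, sum_singleton]
    simp [mwLen]
  rw [hcls, hcls, hcls, hcls, hcls, hstub] at hsum
  have hs3 : Real.sin (3 * π / 16) = Real.cos (5 * π / 16) := by
    rw [← Real.cos_pi_div_two_sub]; congr 1; ring
  have hs1 : Real.sin (π / 16) = Real.cos (7 * π / 16) := by
    rw [← Real.cos_pi_div_two_sub]; congr 1; ring
  have hK : Real.cos (3 * π / 16) = hexCriticalFugacity * (Real.cos (π / 16) + Real.cos (5 * π / 16)) := by
    rw [Real.cos_add_cos, show (π / 16 + 5 * π / 16) / 2 = 3 * π / 16 by ring,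
      show (π / 16 - 5 * π / 16) / 2 = -(π / 8) by ring, Real.cos_neg]
    linear_combination (-Real.cos (3 * π / 16)) * two_mul_hexCriticalFugacity_mul_cos_pi_div_eight
  rw [hs3, hs1, rotTriW]
  linear_combination 2 * hsum + 2 * hK

/-- The face K95.2 in the planner's `∀ M` form (a-idea-1 `Sketch_G17b_K954.lean`, `HV.RotTriIdentity`, token for token).
[cite: Beaton2014RotatedHoneycomb, §2.2, Proposition 4 and its proof; GlazmanManolescu2019, §4.1 and Lemma 4.1] -/
theorem rotTri_identity_all :
    ∀ M : ℕ,
      let V := (rotTriV M).erase wOut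
      2 * Real.sin (3 * Real.pi / 16) * rotGF V IsRotBotOut + 2 * Real.sin (Real.pi / 16) * rotGF V IsRotBotIn +
        rotTriW M + 2 * Real.cos (7 * Real.pi / 16) * rotGF V IsRotCloseDart =
      2 * hexCriticalFugacity * Real.cos (Real.pi / 16) :=
  fun M => rotTri_identity M

/-- **Corollary**: `0 ≤ W_M ≤ 2 x_c cos(π/16) = K/2` for every `M` (all other classes are nonnegative).
[cite: Beaton2014RotatedHoneycomb, Proposition 4 and §4 ("every term … is non-negative"); GlazmanManolescu2019, §4.1] -/
theorem rotTriW_le (M : ℕ) : 0 ≤ rotTriW M ∧ rotTriW M ≤ 2 * hexCriticalFugacity * Real.cos (Real.pi / 16) := by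
  have h := rotTri_identity M
  have hnn : ∀ (cls : HV × HV → Prop) [DecidablePred cls], 0 ≤ rotGF ((rotTriV M).erase wOut) cls :=
    fun cls _ => sum_nonneg fun _ _ => pow_nonneg hexCriticalFugacity_pos_lt_one.1.le _
  have c1 : 0 ≤ Real.cos (Real.pi / 16) := Real.cos_nonneg_of_mem_Icc ⟨by linarith [Real.pi_pos], by linarith [Real.pi_pos]⟩
  have c3 : 0 ≤ Real.cos (3 * Real.pi / 16) := Real.cos_nonneg_of_mem_Icc ⟨by linarith [Real.pi_pos], by linarith [Real.pi_pos]⟩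
  have c7 : 0 ≤ Real.cos (7 * Real.pi / 16) := Real.cos_nonneg_of_mem_Icc ⟨by linarith [Real.pi_pos], by linarith [Real.pi_pos]⟩
  have s1 : 0 ≤ Real.sin (Real.pi / 16) := Real.sin_nonneg_of_nonneg_of_le_pi (by positivity) (by linarith [Real.pi_pos])
  have s3 : 0 ≤ Real.sin (3 * Real.pi / 16) := Real.sin_nonneg_of_nonneg_of_le_pi (by positivity) (by linarith [Real.pi_pos])
  refine ⟨?_, ?_⟩
  · rw [rotTriW]
    exact add_nonneg (mul_nonneg (by positivity) (hnn _)) (mul_nonneg (by positivity) (hnn _))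
  · nlinarith [mul_nonneg s3 (hnn IsRotBotOut), mul_nonneg s1 (hnn IsRotBotIn), mul_nonneg c7 (hnn IsRotCloseDart)]

/-! ### The comparison with the strip (face K95.3 = GM (4.1) in Beaton's frame) and the antitonicity of `W_M` -/

/-- The class generating functions are nonnegative. [cite: Beaton2014RotatedHoneycomb, §2.2 (B_{T,L} ≥ 0)] -/
theorem rotGF_nonneg (V : Finset HV) (cls : HV × HV → Prop) [DecidablePred cls] : 0 ≤ rotGF V cls :=
  sum_nonneg fun _ _ => pow_nonneg hexCriticalFugacity_pos_lt_one.1.le _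

/-- CLASS MONOTONICITY (the engine of the comparison K95.3 and of `W` antitone), PROVED and in fact
trivial in the tree's formalism: for a FIXED dart predicate the GF is monotone under `V ⊆ V'`, because
`midWalks` is (`IsMidWalk.mono`). (Bottom exits / closings of `T_M` are bottom exits / closings of
`D ⊇ T_M`.) [cite: GlazmanManolescu2019, §4.1 (eq. (4.1): the strip identity minus the triangle identity)] -/
theorem rotGF_mono {V V' : Finset HV} (h : V ⊆ V') (cls : HV × HV → Prop) [DecidablePred cls] :
    rotGF V cls ≤ rotGF V' cls := by
  apply sum_le_sum_of_subset_of_nonneg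
  · intro P hP
    simp only [mem_filter] at hP ⊢
    exact ⟨mem_midWalks_iff.2 ((mem_midWalks_iff.1 hP.1).mono h), hP.2⟩
  · intro P _ _
    exact pow_nonneg hexCriticalFugacity_pos_lt_one.1.le _

/-- Beaton's four exit coefficients are positive: `2sin(3π/16), 2sin(π/16), 2cos(3π/16), 2cos(7π/16) > 0`, and
`2cos(π/16) ≥ 1`. [cite: Beaton2014RotatedHoneycomb, Proposition 4 (the coefficients)] -/
theorem rot_coeff_pos :
    0 < 2 * Real.sin (3 * Real.pi / 16) ∧ 0 < 2 * Real.sin (Real.pi / 16) ∧ 0 < 2 * Real.cos (3 * Real.pi / 16) ∧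
      0 < 2 * Real.cos (7 * Real.pi / 16) ∧ 1 ≤ 2 * Real.cos (Real.pi / 16) := by
  have s3 := Real.sin_pos_of_pos_of_lt_pi (x := 3 * Real.pi / 16) (by positivity) (by linarith [Real.pi_pos])
  have s1 := Real.sin_pos_of_pos_of_lt_pi (x := Real.pi / 16) (by positivity) (by linarith [Real.pi_pos])
  have c3 := Real.cos_pos_of_mem_Ioo (x := 3 * Real.pi / 16) ⟨by linarith [Real.pi_pos], by linarith [Real.pi_pos]⟩
  have c7 := Real.cos_pos_of_mem_Ioo (x := 7 * Real.pi / 16) ⟨by linarith [Real.pi_pos], by linarith [Real.pi_pos]⟩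
  have c1 := Real.cos_le_cos_of_nonneg_of_le_pi (x := Real.pi / 16) (y := Real.pi / 3)
    (by positivity) (by linarith [Real.pi_pos]) (by linarith [Real.pi_pos])
  rw [Real.cos_pi_div_three] at c1
  refine ⟨by linarith, by linarith, by linarith, by linarith, by linarith⟩

/-- **`W` is antitone in `M`** (the triangles are nested with the same `a`: in `T_M ⊆ T_{M+1}` the bottom and closing
classes grow, so by the two triangle identities `W_{M+1} ≤ W_M`) — Glazman–Manolescu, Lemma 4.1: "The partition function
`D^Δ_{2L+1}` is decreasing in `L`" (unrotated frame; same argument). [cite: GlazmanManolescu2019, §4.1, Lemma 4.1 (D^Δ_{2L+1} decreasing in L) and its proof] -/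
theorem rotTriW_antitone : Antitone rotTriW := by
  obtain ⟨cO, cI, -, cP, -⟩ := rot_coeff_pos
  apply antitone_nat_of_succ_le
  intro M
  have e := rotTri_identity M
  have e' := rotTri_identity (M + 1)
  have hsub : (rotTriV M).erase wOut ⊆ (rotTriV (M + 1)).erase wOut :=
    erase_subset_erase _ (rotTriV_mono (Nat.le_succ M))
  linarith [mul_le_mul_of_nonneg_left (rotGF_mono hsub IsRotBotOut) cO.le,
    mul_le_mul_of_nonneg_left (rotGF_mono hsub IsRotBotIn) cI.le,
    mul_le_mul_of_nonneg_left (rotGF_mono hsub IsRotCloseDart) cP.le]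

/-- **Face K95.3 — the comparison `c_B · B^{⊥,→}_{D(H,W)} ≤ W_M` for `T_M ⊆ D(H, W)`** (Glazman–Manolescu's (4.1) in
Beaton's frame; tree analogue for the unrotated strip: `HV.stripB_le_triDl`): subtract the strip identity
(`rotStrip_identity`) from the triangle identity, use class monotonicity for the bottom exits and the closings
(`T_M ∖ {a⁻} ⊆ D(H,W) ∖ {a⁻}`), and drop `c_E · E_{D(H,W)} ≥ 0` — Glazman–Manolescu, Lemma 4.1 (4.1):
"`B_{2L+1} ≤ cos(π/8) D^Δ_{2L+1}`" (unrotated frame, via `A^Δ_{2L+1} ≤ A_{2L+1}`; here with Beaton's rotated coefficients).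
[cite: GlazmanManolescu2019, §4.1, Lemma 4.1, eq. (4.1) and its proof; Beaton2014RotatedHoneycomb, Proposition 4] -/
theorem rotStripBR_le_rotTriW {M H Wd : ℕ} (hH : 6 * M + 2 ≤ H) (hW : 2 * M + 1 ≤ Wd) :
    2 * Real.cos (Real.pi / 16) * rotStripBR H Wd ≤ rotTriW M := by
  obtain ⟨cO, cI, cE, cP, -⟩ := rot_coeff_pos
  have e1 := rotStrip_identity (H := H) (Wd := Wd) (by omega) (by omega)
  have e2 := rotTri_identity M
  have hsub : (rotTriV M).erase wOut ⊆ (rotStripV H Wd).erase wOut :=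
    erase_subset_erase _ (rotTriV_subset_rotStripV hH hW)
  rw [rotStripBR_eq_rotGF]
  linarith [mul_le_mul_of_nonneg_left (rotGF_mono hsub IsRotBotOut) cO.le,
    mul_le_mul_of_nonneg_left (rotGF_mono hsub IsRotBotIn) cI.le,
    mul_le_mul_of_nonneg_left (rotGF_mono hsub IsRotCloseDart) cP.le,
    mul_nonneg cE.le (rotGF_nonneg ((rotStripV H Wd).erase wOut) (IsRotLatDart H Wd))]

/-- **All widths**: `B^{⊥,→}_{D(H,W)} ≤ W_M` for every `W` once `6M + 2 ≤ H` (width-monotonicity `rotStripBR_mono_width`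
up to `W ≥ 2M + 1`, then `2cos(π/16) ≥ 1`) — the form consumed by the block package of the lane's R95 (face
`RotTriangleBlocks`, comparison conjunct). [cite: GlazmanManolescu2019, Lemma 4.1; Beaton2014RotatedHoneycomb, §2.2 and Proposition 4] -/
theorem rotStripBR_le_rotTriW_all {M H : ℕ} (hH : 6 * M + 2 ≤ H) (Wd : ℕ) : rotStripBR H Wd ≤ rotTriW M := by
  obtain ⟨-, -, -, -, cB⟩ := rot_coeff_pos
  have hmono : rotStripBR H Wd ≤ rotStripBR H (max Wd (2 * M + 1)) := rotStripBR_mono_width (le_max_left _ _)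
  have hcmp := rotStripBR_le_rotTriW hH (le_max_right Wd (2 * M + 1))
  have hB' := le_mul_of_one_le_left (rotStripBR_nonneg H (max Wd (2 * M + 1))) cB
  linarith

end Assembly

end HV

end Literature.Probability.RandomPlanarGeometry.SAW
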